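import Mathlib.Data.Nat.Choose.Central
import Mathlib.Data.Finset.Powerset
import Literature.Computability.AlgebraicComplexity.PrattTripartitionBounds
import Literature.Computability.AlgebraicComplexity.FlatteningRank
import Literature.Barriers.MatrixMultiplication.UniversalMethodBarrierAsymptoticRank
import HarnessLib

/-!
# Pratt's tensors `T_k`: conciseness, `R̃(T_k) ≥ binom(3k,k)`, and the size of the running-time base

Topic `Computability/AlgebraicComplexity`. First instalment of the proof of
`Literature.Computability.AlgebraicComplexity.pratt2024_thm_1_9` (K. Pratt, STOC 2024,
Thm. 1.9 [Pratt2024SCC]): the algebraic facts about the balanced tripartitioning tensors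
`T_k = tripartitionTensor K k` (Def. 1.4) and the numerical facts about the base
`b_k(ε) = prattBase k ε = (R̃(T_k) + ε) 27^k / (binom(3k,k) binom(2k,k))` that the running-time
analysis of §2 uses silently:

* `TripartitionIndex.exists_disjoint_pair`, `TripartitionIndex.eq_of_disjoint`: every `k`-subset
  `S ⊆ [3k]` is completed to a tripartition `(S, T, U)`, and `S` is determined by `(T, U)`;
* `linearIndependent_xSlices_tripartitionTensor`, **`flatteningRank_tripartitionTensor`**:
  the `x`-slices of `T_k` are linearly independent, so the flattening
  `K^{binom([3k],k)} → K^{binom([3k],k) × binom([3k],k)}` has full rank `binom(3k,k)` — this is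
  Pratt's Prop. 2.1 ("`T_k` is concise … This is immediate");
* **`choose_le_asymptoticRank_tripartitionTensor`**: `binom(3k,k) ≤ R̃(T_k)` (flattening ranks
  lower-bound the asymptotic rank, `flatteningRank_le_asymptoticRank`, CVZ 2023 Ex. 1.4); this is
  what makes the bound of Thm. 1.9 at least the input length `≈ binom(3n,n) · n`;
* `choose_three_mul_choose_two_mul_le` : `binom(3n,n) binom(2n,n) ≤ 27^n` (the multinomial
  coefficient `(3n)!/(n!)³` against `(1+1+1)^{3n}`; Pratt §2: "`binom(3n,n) binom(2n,n) / … < 27^{kr} / …`");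
* `pow_lt_prattBase`: `(27/4)^k < b_k(ε)` for `k ≥ 1`, `ε > 0` (so `b_k(ε)^{n/k} ≥ 6.75^n`);
* `exists_tensorRank_kroneckerPow_lt`: the infimum defining `R̃` is approached:
  `∀ δ > 0, ∃ m ≥ 1, R(t^{⊗m}) < (R̃(t) + δ)^m` — the rank decomposition "of a fixed power of
  `T_k`" from which Pratt's algorithm is built (§2, proof of Thm. 1.9).

Nothing here is specific to `ℂ` except where `prattBase` (stated over `ℂ`) is concerned.

## References

* [Pratt2024SCC] K. Pratt, *A stronger connection between the asymptotic rank conjecture and the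
  set cover conjecture*, Proc. 56th STOC (2024), arXiv:2311.02774 — Def. 1.4, Prop. 2.1, proof of
  Thm. 1.9 (§2).
* [ChristandlVranaZuiddam2023] M. Christandl, P. Vrana, J. Zuiddam, *Universal points in the
  asymptotic spectrum of tensors*, JAMS 36 (2023), Example 1.4 (flattening ranks `≤ R̃`).
-/

noncomputable section

open scoped BigOperators

namespace Literature.Computability.AlgebraicComplexity

universe u

/-! ## Completing a `k`-subset of `[3k]` to a tripartition -/

namespace TripartitionIndex

/-- Every `k`-subset `S ⊆ [3k]` is the first block of a tripartition `(S, T, U)` of `[3k]` into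
`k`-subsets (split the `2k`-element complement into two halves). [cite: Pratt2024SCC, Prop. 2.1] -/
theorem exists_disjoint_pair {k : ℕ} (S : TripartitionIndex k) :
    ∃ T U : TripartitionIndex k, Disjoint S.1 T.1 ∧ Disjoint S.1 U.1 ∧ Disjoint T.1 U.1 := by
  classical
  obtain ⟨S, hS⟩ := S
  have hc : (Sᶜ).card = 2 * k := by
    rw [Finset.card_compl, hS, Fintype.card_fin]; omega
  obtain ⟨T, hTS, hT⟩ := Finset.exists_subset_card_eq (s := Sᶜ) (n := k) (by omega)
  refine ⟨⟨T, hT⟩, ⟨Sᶜ \ T, ?_⟩, ?_, ?_, ?_⟩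
  · rw [Finset.card_sdiff_of_subset hTS, hc, hT]; omega
  · exact Finset.disjoint_left.2 fun a haS haT => (Finset.mem_compl.1 (hTS haT)) haS
  · exact Finset.disjoint_left.2 fun a haS haU =>
      (Finset.mem_compl.1 (Finset.mem_sdiff.1 haU).1) haS
  · exact Finset.disjoint_sdiff

/-- In a tripartition `(S, T, U)` of `[3k]` into `k`-subsets, `S` is determined by `(T, U)`
(it is the complement of `T ∪ U`). [cite: Pratt2024SCC, Prop. 2.1] -/
theorem eq_of_disjoint {k : ℕ} {S S' T U : TripartitionIndex k}
    (h : Disjoint S.1 T.1 ∧ Disjoint S.1 U.1 ∧ Disjoint T.1 U.1)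
    (h' : Disjoint S'.1 T.1 ∧ Disjoint S'.1 U.1 ∧ Disjoint T.1 U.1) : S' = S := by
  have hu := (disjoint_iff_union_eq_univ S T U).1 h
  have hu' := (disjoint_iff_union_eq_univ S' T U).1 h'
  have key : ∀ {A : Finset (Fin (3 * k))}, Disjoint A T.1 → Disjoint A U.1 →
      A ∪ T.1 ∪ U.1 = Finset.univ → A = (T.1 ∪ U.1)ᶜ := by
    intro A hAT hAU hA
    ext a
    simp only [Finset.mem_compl, Finset.mem_union, not_or]
    constructor
    · intro ha
      exact ⟨Finset.disjoint_left.1 hAT ha, Finset.disjoint_left.1 hAU ha⟩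
    · rintro ⟨haT, haU⟩
      have : a ∈ A ∪ T.1 ∪ U.1 := hA ▸ Finset.mem_univ a
      simp only [Finset.mem_union] at this
      tauto
  exact Subtype.ext ((key h'.1 h'.2.1 hu').trans (key h.1 h.2.1 hu).symm)

end TripartitionIndex

/-! ## Conciseness: the flattening rank of `T_k` is `binom(3k,k)` (Pratt, Prop. 2.1) -/

section Flattening

variable (K : Type u) [Field K]

/-- The `x`-slices of `T_k` are linearly independent: the slice of `S` is `1` at a completing
pair `(T, U)` where every other slice vanishes. [cite: Pratt2024SCC, Prop. 2.1] -/
theorem linearIndependent_xSlices_tripartitionTensor (k : ℕ) :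
    LinearIndependent K (xSlices (tripartitionTensor K k)) := by
  classical
  rw [Fintype.linearIndependent_iff]
  intro g hg S
  obtain ⟨T, U, hSTU⟩ := S.exists_disjoint_pair
  have h := congrFun hg (T, U)
  rw [Finset.sum_apply, Finset.sum_eq_single S] at h
  · simpa [xSlices_apply, tripartitionTensor_apply, hSTU] using h
  · intro S' _ hS'
    have hnot : ¬ (Disjoint S'.1 T.1 ∧ Disjoint S'.1 U.1 ∧ Disjoint T.1 U.1) :=
      fun h' => hS' (TripartitionIndex.eq_of_disjoint hSTU h')
    simp [xSlices_apply, tripartitionTensor_apply, hnot]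
  · exact fun h => absurd (Finset.mem_univ S) h

/-- **`ζ⁽¹⁾(T_k) = binom(3k,k)`**: the flattening of `T_k` along the first factor has full rank,
i.e. `T_k` is concise in the first factor (and by symmetry in all three) — Pratt, Prop. 2.1.
[cite: Pratt2024SCC, Prop. 2.1] -/
theorem flatteningRank_tripartitionTensor (k : ℕ) :
    flatteningRank (tripartitionTensor K k) = (3 * k).choose k := by
  rw [flatteningRank, finrank_span_eq_card (linearIndependent_xSlices_tripartitionTensor K k),
    TripartitionIndex.card]

/-- `binom(3k,k) ≤ R(T_k)` (conciseness; Pratt §1.1: "if `T` is concise, then `R(T) ≥ n`").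
[cite: Pratt2024SCC, Prop. 2.1] -/
theorem choose_le_tensorRank_tripartitionTensor (k : ℕ) :
    (3 * k).choose k ≤ tensorRank (tripartitionTensor K k) :=
  (flatteningRank_tripartitionTensor K k).symm.le.trans (flatteningRank_le_tensorRank _)

/-- **`binom(3k,k) ≤ R̃(T_k)`**: flattening ranks lower-bound the asymptotic rank
(CVZ 2023, Example 1.4) and `ζ⁽¹⁾(T_k) = binom(3k,k)`. [cite: Pratt2024SCC, Prop. 2.1] -/
theorem choose_le_asymptoticRank_tripartitionTensor (k : ℕ) :
    ((3 * k).choose k : ℝ) ≤ asymptoticRank (tripartitionTensor K k) := by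
  have h := Literature.Barriers.MatrixMultiplication.flatteningRank_le_asymptoticRank
    (tripartitionTensor K k)
  rwa [flatteningRank_tripartitionTensor] at h

end Flattening

/-! ## Binomial arithmetic -/

/-- `binom(3n,n) · binom(2n,n) ≤ 27^n`: the trinomial coefficient `(3n)!/(n!)³` is a term of
`(1+1+1)^{3n}`; proved by the ratio `f(n+1)/f(n) = 3(3n+1)(3n+2)/(n+1)² ≤ 27`.
[cite: Pratt2024SCC, §2 (proof of Thm. 1.9, last display)] -/
theorem choose_three_mul_choose_two_mul_le (n : ℕ) :
    (3 * n).choose n * (2 * n).choose n ≤ 27 ^ n := by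
  -- `f n * (n!)^3 = (3n)!`
  have hf : ∀ n : ℕ, (3 * n).choose n * (2 * n).choose n * (n.factorial * n.factorial * n.factorial)
      = (3 * n).factorial := by
    intro n
    have h1 := Nat.choose_mul_factorial_mul_factorial (show n ≤ 3 * n by omega)
    have h2 := Nat.choose_mul_factorial_mul_factorial (show n ≤ 2 * n by omega)
    rw [show 3 * n - n = 2 * n by omega] at h1
    rw [show 2 * n - n = n by omega] at h2
    calc (3 * n).choose n * (2 * n).choose n * (n.factorial * n.factorial * n.factorial)
        = (3 * n).choose n * n.factorial * ((2 * n).choose n * n.factorial * n.factorial) := by ring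
      _ = (3 * n).factorial := by rw [h2, h1]
  induction n with
  | zero => simp
  | succ n ih =>
    -- compare `f (n+1) ((n+1)!)^3 = (3n+3)!` with `f n (n!)^3 = (3n)!`
    have hpos : 0 < (n + 1).factorial * (n + 1).factorial * (n + 1).factorial := by positivity
    refine Nat.le_of_mul_le_mul_right ?_ hpos
    rw [hf (n + 1)]
    have e3 : (3 * (n + 1)).factorial = (3 * n + 3) * (3 * n + 2) * (3 * n + 1) * (3 * n).factorial := by
      rw [show 3 * (n + 1) = 3 * n + 2 + 1 by ring, Nat.factorial_succ,
        show 3 * n + 2 = 3 * n + 1 + 1 by ring, Nat.factorial_succ, Nat.factorial_succ]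
      ring
    have e1 : (n + 1).factorial = (n + 1) * n.factorial := Nat.factorial_succ n
    rw [e3, ← hf n, e1]
    have key : (3 * n + 3) * (3 * n + 2) * (3 * n + 1) ≤ 27 * ((n + 1) * (n + 1) * (n + 1)) := by
      nlinarith
    calc (3 * n + 3) * (3 * n + 2) * (3 * n + 1) *
          ((3 * n).choose n * (2 * n).choose n * (n.factorial * n.factorial * n.factorial))
        ≤ 27 * ((n + 1) * (n + 1) * (n + 1)) *
          (27 ^ n * (n.factorial * n.factorial * n.factorial)) := by gcongr
      _ = 27 ^ (n + 1) * ((n + 1) * n.factorial * ((n + 1) * n.factorial) *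
          ((n + 1) * n.factorial)) := by ring

/-- `binom(2k,k) < 4^k` for `k ≥ 1` (Mathlib's `Nat.centralBinom_lt_four_pow`). [folklore] -/
theorem choose_two_mul_lt_four_pow {k : ℕ} (hk : 1 ≤ k) : (2 * k).choose k < 4 ^ k := by
  simpa [Nat.centralBinom_eq_two_mul_choose] using Nat.centralBinom_lt_four_pow (n := k) (by omega)

/-! ## The base of the running time: `b_k(ε) > (27/4)^k` -/

/-- `b_k(ε) ≥ (binom(3k,k) + ε) · 27^k / (binom(3k,k) binom(2k,k))` (monotonicity in `R̃(T_k)`,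
which is at least `binom(3k,k)`). [cite: Pratt2024SCC, Thm. 1.9] -/
theorem prattBase_ge (k : ℕ) (ε : ℝ) :
    ((3 * k).choose k + ε) * 27 ^ k / ((3 * k).choose k * (2 * k).choose k) ≤ prattBase k ε := by
  rw [prattBase_def]
  have h1 : (0 : ℝ) < (3 * k).choose k := by exact_mod_cast Nat.choose_pos (by omega)
  have h2 : (0 : ℝ) < (2 * k).choose k := by exact_mod_cast Nat.choose_pos (by omega)
  have h3 := choose_le_asymptoticRank_tripartitionTensor ℂ k
  gcongr

/-- **`(27/4)^k < b_k(ε)`** for `k ≥ 1` and `ε ≥ 0`: with `R̃(T_k) ≥ binom(3k,k)` and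
`binom(2k,k) < 4^k`, `b_k(ε) ≥ 27^k / binom(2k,k) > (27/4)^k`. Consequently the running time
`b_k(ε)^{n/k}` of Thm. 1.9 dominates `6.75^n ≥ binom(3n,n)`, the number of possible input sets.
[cite: Pratt2024SCC, Thm. 1.9] -/
theorem pow_lt_prattBase {k : ℕ} (hk : 1 ≤ k) {ε : ℝ} (hε : 0 ≤ ε) :
    (27 / 4 : ℝ) ^ k < prattBase k ε := by
  have h1 : (0 : ℝ) < (3 * k).choose k := by exact_mod_cast Nat.choose_pos (by omega)
  have h2 : (0 : ℝ) < (2 * k).choose k := by exact_mod_cast Nat.choose_pos (by omega)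
  have h4 : ((2 * k).choose k : ℝ) < 4 ^ k := by exact_mod_cast choose_two_mul_lt_four_pow hk
  refine lt_of_lt_of_le ?_ (prattBase_ge k ε)
  rw [div_pow, lt_div_iff₀ (mul_pos h1 h2)]
  calc (27 : ℝ) ^ k / 4 ^ k * ((3 * k).choose k * (2 * k).choose k)
      = ((3 * k).choose k) * 27 ^ k * (((2 * k).choose k) / 4 ^ k) := by ring
    _ < ((3 * k).choose k) * 27 ^ k * 1 := by
        gcongr
        rwa [div_lt_one (by positivity)]
    _ ≤ ((3 * k).choose k + ε) * 27 ^ k := by nlinarith [pow_pos (show (0:ℝ) < 27 by norm_num) k]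

/-- `b_k(ε)^{n/k} ≥ (27/4)^n` for `k ≥ 1`, `ε ≥ 0`: the time bound of Thm. 1.9 is at least
`6.75^n`. [cite: Pratt2024SCC, Thm. 1.9] -/
theorem pow_le_prattBase_rpow {k : ℕ} (hk : 1 ≤ k) {ε : ℝ} (hε : 0 ≤ ε) (n : ℕ) :
    (27 / 4 : ℝ) ^ n ≤ prattBase k ε ^ ((n : ℝ) / k) := by
  have hb := pow_lt_prattBase hk hε
  have hk0 : (0 : ℝ) < k := by exact_mod_cast hk
  have h0 : (0 : ℝ) ≤ 27 / 4 := by norm_num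
  calc (27 / 4 : ℝ) ^ n = (((27 / 4 : ℝ) ^ k) ^ ((k : ℝ)⁻¹)) ^ (n : ℝ) := by
        rw [← Real.rpow_natCast ((27:ℝ)/4) k, ← Real.rpow_mul h0, mul_inv_cancel₀ hk0.ne',
          Real.rpow_one, Real.rpow_natCast]
    _ ≤ (prattBase k ε ^ ((k : ℝ)⁻¹)) ^ (n : ℝ) := by
        gcongr
    _ = prattBase k ε ^ ((n : ℝ) / k) := by
        rw [← Real.rpow_mul (le_of_lt ((pow_pos (by norm_num) k).trans hb)), div_eq_inv_mul]

/-! ## The infimum defining `R̃` is approached by a fixed power -/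

section Infimum

variable {K : Type u} [Field K] {ι κ μ : Type*} [Fintype ι] [Fintype κ] [Fintype μ]

/-- **A rank decomposition of a fixed power**: for every `δ > 0` some power `t^{⊗m}`, `m ≥ 1`,
has `R(t^{⊗m}) < (R̃(t) + δ)^m` (the definition of `R̃` as an infimum). This is the
decomposition "of a fixed power of `T_k`" hard-wired into Pratt's algorithm.
[cite: Pratt2024SCC, §2 (proof of Thm. 1.9)] -/
theorem exists_tensorRank_kroneckerPow_lt (t : ι → κ → μ → K) {δ : ℝ} (hδ : 0 < δ) :
    ∃ m : ℕ, 1 ≤ m ∧ (tensorRank (kroneckerPow t m) : ℝ) < (asymptoticRank t + δ) ^ m := by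
  have hlt : asymptoticRank t < asymptoticRank t + δ := by linarith
  unfold asymptoticRank at hlt ⊢
  obtain ⟨N, hN⟩ := exists_lt_of_ciInf_lt hlt
  refine ⟨N + 1, by omega, ?_⟩
  have hx : (0 : ℝ) ≤ (tensorRank (kroneckerPow t (N + 1)) : ℝ) := Nat.cast_nonneg _
  have hpos : (0 : ℝ) < (N : ℝ) + 1 := by positivity
  have hy : 0 ≤ (⨅ N : ℕ, ((tensorRank (kroneckerPow t (N + 1)) : ℝ) ^ ((N : ℝ) + 1)⁻¹)) + δ :=
    le_of_lt (lt_of_le_of_lt (Real.rpow_nonneg hx _) hN)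
  calc (tensorRank (kroneckerPow t (N + 1)) : ℝ)
      = (((tensorRank (kroneckerPow t (N + 1)) : ℝ) ^ ((N : ℝ) + 1)⁻¹)) ^ ((N : ℝ) + 1) := by
        rw [← Real.rpow_mul hx, inv_mul_cancel₀ hpos.ne', Real.rpow_one]
    _ < ((⨅ N : ℕ, ((tensorRank (kroneckerPow t (N + 1)) : ℝ) ^ ((N : ℝ) + 1)⁻¹)) + δ) ^
          ((N : ℝ) + 1) := Real.rpow_lt_rpow (Real.rpow_nonneg hx _) hN hpos
    _ = _ := by rw [show ((N : ℝ) + 1) = ((N + 1 : ℕ) : ℝ) by push_cast; ring, Real.rpow_natCast]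

end Infimum

end Literature.Computability.AlgebraicComplexity
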